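import Literature.AnabelianGeometry.EtaleTheta.TemperedFrobenioidOfGaloisCoveringOneComponentWeak
import Literature.AnabelianGeometry.EtaleTheta.TemperedFrobenioidOfGaloisCoveringTateTower
import HarnessLib

/-!
# [EtTh] Def 3.6 (ii), MONOID TYPE `ℝ`: tempered Frobenioids over the constructed connected Def 3.3 (iii) data
# `ofRlfRWeak (ofGaloisActionConnected A hZ) hpf` (`B₀^ℝ = ℝ·Φ₀^birat`) at any rank-one point — and at the Tate tower

S. Mochizuki, *The étale theta function and its Frobenioid-theoretic manifestations*, Publ. RIMS **45** (2009)
[MochizukiEtTh2009], Def. 3.6 (i) PDF p. 76 ("`B₀^Λ` for … `ℝ·Φ₀^birat` if `Λ = ℝ`", "`F₀^Λ ⊆ B₀^Λ` for … `ℝ·Φ₀^cnst`"),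
Def. 3.6 (ii) p. 77 [cite: MochizukiEtTh2009, Def 3.6 p.77].

abc-iut cell, block C / W6, seat abc-iut-w6-d048 (gen 3); R227 «§3 weak column at `Λ = ℝ`» + R311 NV row.  CLASS (b) NV file
(one `def` = the `Λ = ℝ` engine, plus instance `def`s; everything landed consumed BY NAME: this seat's `RankOnePoint` /
`ofRankOnePoint` engine (p444230), `OneCompFrd.rankOnePoint` (p445878), `TateTowerFrd.rankOnePoint` (p446077), abc-iut-L6-t12's
`ofRlfRWeak`, abc-iut-L2-d2's `PfImageWeak.*` / `toRlfGp_realDataWeak_eq`).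

WHY.  This seat's `Λ = ℝ` theorem family at the constructed data (`isFrobenioid_ofRlfRWeak_ofGaloisActionConnected_of_isOfFSMType`,
`…_connectedPart_bTemp`, p439556; abc-iut-w5-d179's `Sec3OfGaloisCoveringConnectedRealified` §2 «`C` slim» for `Λ = ℝ`) quantifies
over `TemperedFrobenioid (ofRlfRWeak (ofGaloisActionConnected A hZ) hpf) D VD`, a class with NO inhabitant so far (the `Λ = ℤ`
witnesses p445878 / p446077 live over `ofRlfZWeak`).  THIS FILE: for every rank-one point `P : RankOnePoint A`,
* **`TemperedFrobenioid.ofRankOnePointR`** — Def. 3.6 (ii) data of monoid type `ℝ`: `D = {pt} ↦ S₀`, `Φ := im(Φ₀(S₀)^pf →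
  Φ₀(S₀)^rlf)` (the SAME divisor monoid as at `Λ = ℤ`: `ofRlfRWeak` and `ofRlfZWeak` share `Φ₀^ℝ` and `ℝ·Φ₀^cnst`), (a) as
  before, (b) the element `ι(div₀ b₁) ∈ B₀^ℝ = ℝ·Φ₀^birat` (`b₁` the constant with `div₀ b₁ = e⁻¹(1)`) lies in
  `F₀^ℝ = B₀^ℝ ∩ ℝ·Φ₀^cnst` and has log-divisor `ι(e⁻¹ 1)/1 ≠ 1`;
* instances `OneCompFrd.temperedFrobenioidR` (smooth-reduction twin) and **`TateTowerFrd.temperedFrobenioidR`** (model of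
  record) + `nonempty_…` (+ over `ConnectedPart (BTemp Π)`), and the token `TateTowerFrd.isFrobenioid_temperedFrobenioidR_byName`
  — this seat's hypothesis-free `Λ = ℝ` «`C` IS a Frobenioid» INSTANTIATED at the tower.
HONEST LABEL as in the `Λ = ℤ` files: one point of `D₀`, degenerate / skeletal geometry, no bi-Kummer data claimed.  Nothing here
bears on [IUTchIII] Cor. 3.12; no side taken; typed ≠ proved for anything else.
-/

noncomputable section

namespace Literature.AnabelianGeometry.EtaleTheta

open CategoryTheory Opposite Function Literature.AlgebraicGeometry.Frobenioids
  Literature.AnabelianGeometry.SemiGraphs LogDivisorModel LogDivisorModel.GaloisAction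

namespace TemperedFrobenioid

variable {Z : LogDivisorModel.{0}} {G : Type} [Group G] {A : Z.GaloisAction G} (hZ : Z.CuspLaws) (P : RankOnePoint A)
  (hpf : ∀ Y : ((isConnectedGSet (G := G)).FullSubcategory)ᵒᵖ,
    IsPerfFactorialCof ((DivisorMonoids.ofGaloisActionConnected A hZ).Φ₀.obj Y))

namespace RankOnePoint

/-- The weak Def. 3.6 (i) data of monoid type `ℝ` over the constructed connected data (`B₀^ℝ = ℝ·Φ₀^birat`).
[cite: MochizukiEtTh2009, Def 3.6 p.76] -/
abbrev TR : RealifiedDivisorMonoids (D₀ := (isConnectedGSet (G := G)).FullSubcategory) treeMonoidVocabWeak.{0} :=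
  RealifiedDivisorMonoids.ofRlfRWeak (DivisorMonoids.ofGaloisActionConnected A hZ) hpf

/-- The image `ι(c) ∈ (Φ₀^ℝ)^gp(S₀)` of a log-divisor class `c ∈ Φ₀(S₀)^gp` that is the divisor of a function lies in
`B₀^ℝ(S₀) = ℝ·Φ₀^birat(S₀)`. [cite: MochizukiEtTh2009, Def 3.6 p.76] -/
theorem gpMap_toR_mem_realSpan_biratGp {c : Algebra.GrothendieckGroup ((DivisorMonoids.ofGaloisActionConnected A hZ).Φ₀.obj (op P.S₀))}
    (b : A.bZero P.S₀.obj) (hbc : A.divZeroHom P.S₀.obj b = c) :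
    EtaleTheta.gpMap ((TR hZ hpf).toR (op P.S₀)) c ∈
      ((RealifiedDivisorMonoids.realDataWeak (DivisorMonoids.ofGaloisActionConnected A hZ) hpf).realSpan
        (DivisorMonoids.ofGaloisActionConnected A hZ).biratGp).carrier P.S₀ := by
  have h := (RealifiedDivisorMonoids.realDataWeak (DivisorMonoids.ofGaloisActionConnected A hZ) hpf).toRlfGp_mem_realSpan
    (DivisorMonoids.ofGaloisActionConnected A hZ).biratGp P.S₀ (c := c) (Subgroup.subset_closure ⟨b, hbc⟩)
  rw [RealifiedDivisorMonoids.toRlfGp_realDataWeak_eq] at h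
  exact h

/-- The constant `ι(div₀ b) ∈ B₀^ℝ(S₀)` attached to `m ∈ Φ₀(S₀)` (`b` a constant function with `div₀ b = m`, from `hcnst`).
[cite: MochizukiEtTh2009, Def 3.6 p.76] -/
def cnstFnR (m : A.phiZero P.S₀.obj) : (TR hZ hpf).BΛ.obj (op P.S₀) :=
  ⟨EtaleTheta.gpMap ((TR hZ hpf).toR (op P.S₀)) (Algebra.GrothendieckGroup.of m),
    P.gpMap_toR_mem_realSpan_biratGp hZ hpf (P.hcnst m).choose (P.hcnst m).choose_spec.2⟩

/-- `ι(div₀ b) ∈ F₀^ℝ(S₀) = B₀^ℝ(S₀) ∩ ℝ·Φ₀^cnst(S₀)` (the function `b` is constant). [cite: MochizukiEtTh2009, Def 3.6 p.76] -/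
theorem cnstFnR_mem_FΛ (m : A.phiZero P.S₀.obj) : P.cnstFnR hZ hpf m ∈ (TR hZ hpf).FΛ (op P.S₀) := by
  obtain ⟨hb, hbm⟩ := (P.hcnst m).choose_spec
  have key := (TR hZ hpf).cnst_le_cnstR (op P.S₀) (P.hcnst m).choose hb
  change EtaleTheta.gpMap ((TR hZ hpf).toR (op P.S₀)) ((DivisorMonoids.ofGaloisActionConnected A hZ).div₀ (op P.S₀)
    (P.hcnst m).choose) ∈ (TR hZ hpf).cnstR (op P.S₀) at key
  rw [show (DivisorMonoids.ofGaloisActionConnected A hZ).div₀ (op P.S₀) (P.hcnst m).choose =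
    Algebra.GrothendieckGroup.of m from hbm] at key
  exact key

/-- Its log-divisor `Div(ι(div₀ b)) ∈ (Φ₀^ℝ)^gp(S₀)` is `ι(m)` (`B₀^ℝ → (Φ₀^ℝ)^gp` is the inclusion).
[cite: MochizukiEtTh2009, Def 3.6 p.76] -/
theorem divΛ_cnstFnR (m : A.phiZero P.S₀.obj) :
    (TR hZ hpf).divΛ (op P.S₀) (P.cnstFnR hZ hpf m) =
      EtaleTheta.gpMap ((TR hZ hpf).toR (op P.S₀)) (Algebra.GrothendieckGroup.of m) := rfl

end RankOnePoint

variable (R S : ((Discrete PUnit.{1})ᵒᵖ ⥤ CommMonCat.{0}) → Prop)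

/-- **Def. 3.6 (ii) data of MONOID TYPE `ℝ` over the constructed connected Def. 3.3 (iii) data at a rank-one point**
(`B₀^ℝ = ℝ·Φ₀^birat`; base `pt ↦ S₀`; `Φ := im(Φ₀(S₀)^pf → Φ₀(S₀)^rlf)` as at `Λ = ℤ`); every condition PROVED.
[cite: MochizukiEtTh2009, Def 3.6 p.77] -/
def ofRankOnePointR : TemperedFrobenioid (RankOnePoint.TR hZ hpf) (Discrete PUnit.{1}) (treeCatVocab (Discrete PUnit.{1}) R S) where
  isConnected := Toy.temperedFrobenioid.isConnected
  isTotallyEpimorphic := Toy.temperedFrobenioid.isTotallyEpimorphic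
  base := P.base
  Φ := P.Φsub hZ hpf
  isGroupSaturated _ := PfImageWeak.isGroupSaturated_mrange_toRealification (hpf (op P.S₀)).weak
  isPerfFactorial _ := PfImageWeak.isPerfFactorialCof_mrange_toRealification (hpf (op P.S₀))
  isDivisorialOn := by
    rw [treeCatVocab_isDivisorialOn]
    exact ⟨Cor38Toy.isMonoidOn_of_punit _, fun _ => PfImageWeak.isDivisorial_mrange_toRealification (hpf (op P.S₀))⟩
  isMonoprime_bsFld _ :=
    IsMonoprime.of_mulEquiv (MulEquiv.submonoidCongr (P.pfImage_inf_cnstR_eq hZ hpf).symm) (P.isMonoprime_pfImage hZ hpf)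
  exists_FΛ_div_ne _ :=
    ⟨P.cnstFnR hZ hpf (P.e.symm (Multiplicative.ofAdd 1)), P.cnstFnR_mem_FΛ hZ hpf _,
      (hpf (op P.S₀)).weak.toRealification (Perfection.of _ (P.e.symm (Multiplicative.ofAdd 1))), ⟨_, rfl⟩,
      1, one_mem _, P.toRealification_gen_ne_one hZ hpf, by
        simp only [map_one, div_one]
        change (RankOnePoint.TR hZ hpf).divΛ (op P.S₀) (P.cnstFnR hZ hpf (P.e.symm (Multiplicative.ofAdd 1))) = _
        rw [RankOnePoint.divΛ_cnstFnR]
        exact EtaleTheta.gpMap_of _ _⟩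

/-- The monoid type of the witness is `ℝ`. [cite: MochizukiEtTh2009, Def 3.6 p.77] -/
theorem ofRankOnePointR_monoidType : (ofRankOnePointR hZ P hpf R S).monoidType = MonoidType.R := rfl

/-- **NON-VACUITY of the `Λ = ℝ` theorem family at the constructed data** (one-point base).
[cite: MochizukiEtTh2009, Def 3.6 p.77] -/
theorem nonempty_of_rankOnePointR (P₀ : RankOnePoint A) (R₀ S₀ : ((Discrete PUnit.{1})ᵒᵖ ⥤ CommMonCat.{0}) → Prop) :
    Nonempty (TemperedFrobenioid (RealifiedDivisorMonoids.ofRlfRWeak (DivisorMonoids.ofGaloisActionConnected A hZ) hpf)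
      (Discrete PUnit.{1}) (treeCatVocab (Discrete PUnit.{1}) R₀ S₀)) :=
  ⟨ofRankOnePointR hZ P₀ hpf R₀ S₀⟩

/-- … and over print's genuine base `B^temp(Π)⁰`, every topological group `Π`. [cite: MochizukiEtTh2009, Def 3.6 p.77] -/
theorem nonempty_of_rankOnePointR_connectedPart (P₀ : RankOnePoint A) (Γ : Type) [Group Γ] [TopologicalSpace Γ]
    (R₁ S₁ : ((ConnectedPart (BTemp Γ))ᵒᵖ ⥤ CommMonCat.{0}) → Prop) :
    Nonempty (TemperedFrobenioid (RealifiedDivisorMonoids.ofRlfRWeak (DivisorMonoids.ofGaloisActionConnected A hZ) hpf)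
      (ConnectedPart (BTemp Γ)) (treeCatVocab (ConnectedPart (BTemp Γ)) R₁ S₁)) :=
  ⟨(ofRankOnePointR hZ P₀ hpf (fun _ => True) (fun _ => True)).restrictConnectedPart Γ ((Functor.const _).obj ⟨PUnit.unit⟩) R₁ S₁⟩

end TemperedFrobenioid

/-! ### Instances: the one-component twin and the Tate tower (model of record) -/

namespace OneCompFrd

variable (U : Type) [CommGroup U] (hU : ∀ u : U, (∀ N : ℕ+, ∃ g : U, g ^ (N : ℕ) = u) → u = 1)
  (R S : ((Discrete PUnit.{1})ᵒᵖ ⥤ CommMonCat.{0}) → Prop)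

/-- **The tempered Frobenioid of MONOID TYPE `ℝ` of the one-component model** over the weak constructed data.
[cite: MochizukiEtTh2009, Def 3.6 p.77] -/
def temperedFrobenioidR :
    TemperedFrobenioid (RealifiedDivisorMonoids.ofRlfRWeak (dm U hU) (hpfCof_oneComp U hU)) (Discrete PUnit.{1})
      (treeCatVocab (Discrete PUnit.{1}) R S) :=
  TemperedFrobenioid.ofRankOnePointR (cuspLaws_oneComp U hU) (rankOnePoint U hU) (hpfCof_oneComp U hU) R S

/-- Its monoid type is `ℝ`. [cite: MochizukiEtTh2009, Def 3.6 p.77] -/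
theorem temperedFrobenioidR_monoidType : (temperedFrobenioidR U hU R S).monoidType = MonoidType.R := rfl

end OneCompFrd

namespace TateTowerFrd

variable (R S : ((Discrete PUnit.{1})ᵒᵖ ⥤ CommMonCat.{0}) → Prop)

/-- **The tempered Frobenioid of MONOID TYPE `ℝ` at the bottom of the TATE TOWER** (model of record), over
`ofRlfRWeak (ofGaloisActionConnected TateTower.action TateTower.cuspLaws) hpf`. [cite: MochizukiEtTh2009, Def 3.6 p.77] -/
def temperedFrobenioidR :
    TemperedFrobenioid (RealifiedDivisorMonoids.ofRlfRWeak dm hpf) (Discrete PUnit.{1}) (treeCatVocab (Discrete PUnit.{1}) R S) :=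
  TemperedFrobenioid.ofRankOnePointR TateTower.cuspLaws rankOnePoint hpf R S

/-- Its monoid type is `ℝ`. [cite: MochizukiEtTh2009, Def 3.6 p.77] -/
theorem temperedFrobenioidR_monoidType : (temperedFrobenioidR R S).monoidType = MonoidType.R := rfl

/-- **NON-VACUITY, `Λ = ℝ`, at the model of record.** [cite: MochizukiEtTh2009, Def 3.6 p.77] -/
theorem nonempty_temperedFrobenioidR :
    Nonempty (TemperedFrobenioid (RealifiedDivisorMonoids.ofRlfRWeak
      (DivisorMonoids.ofGaloisActionConnected TateTower.action TateTower.cuspLaws) hpf)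
      (Discrete PUnit.{1}) (treeCatVocab (Discrete PUnit.{1}) R S)) :=
  ⟨temperedFrobenioidR R S⟩

/-- **This seat's hypothesis-free `Λ = ℝ` «`C` IS a Frobenioid» (p439556 §3) INSTANTIATED at the tower.**
[cite: MochizukiEtTh2009, Def 3.6 p.77] -/
theorem isFrobenioid_temperedFrobenioidR_byName : PreFrobenioid.IsFrobenioid (temperedFrobenioidR R S).toElem :=
  TemperedFrobenioid.isFrobenioid_ofRlfRWeak_ofGaloisActionConnected_of_isOfFSMType TateTower.action TateTower.cuspLaws hpf
    (temperedFrobenioidR R S) PadicFrd.isOfFSMType_discretePUnit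

/-- Non-vacuity, `Λ = ℝ`, model of record, genuine base `B^temp(Π)⁰` (every topological group `Π`).
[cite: MochizukiEtTh2009, Def 3.6 p.77] -/
theorem nonempty_temperedFrobenioidR_connectedPart (Γ : Type) [Group Γ] [TopologicalSpace Γ]
    (R' S' : ((ConnectedPart (BTemp Γ))ᵒᵖ ⥤ CommMonCat.{0}) → Prop) :
    Nonempty (TemperedFrobenioid (RealifiedDivisorMonoids.ofRlfRWeak
      (DivisorMonoids.ofGaloisActionConnected TateTower.action TateTower.cuspLaws) hpf)
      (ConnectedPart (BTemp Γ)) (treeCatVocab (ConnectedPart (BTemp Γ)) R' S')) :=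
  TemperedFrobenioid.nonempty_of_rankOnePointR_connectedPart TateTower.cuspLaws hpf rankOnePoint Γ R' S'

end TateTowerFrd

end Literature.AnabelianGeometry.EtaleTheta

end
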